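import Mathlib
import HarnessLib
import Literature.Analysis.FluidPDE.Seregin2020CubicLowerBound
import Literature.Analysis.FluidPDE.LocalTypeILiouville
import Literature.Analysis.FluidPDE.TypeIAncientMildDecay
import Summits.NavierStokesRegularity.NavierStokesRegularity.Theorems.StableStrataDoorSingularProfileTools
import Summits.NavierStokesRegularity.NavierStokesRegularity.Theorems.StableStrataDoorOneSliceDefs
import Summits.NavierStokesRegularity.NavierStokesRegularity.Theorems.StableStrataDoorAlongTimes
import Summits.NavierStokesRegularity.NavierStokesRegularity.Theorems.RellichScarScarRigidityApexRegularity
import Summits.NavierStokesRegularity.NavierStokesRegularity.Theorems.AdaptedFrequencyFrequencyRigidityClassicalSuitableSlab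
import Summits.NavierStokesRegularity.NavierStokesRegularity.Theorems.AdaptedFrequencyTangentFlowTransferAncientPressure

/-!
# StableStrataDoorSingularProfileFloor — SEED-26 input **I1b `SingularProfileFloor` PROVED** (door S26 «StableStrataDoor»;
# nsreg-p1 g21 ADDENDUM-25A v5; text = `StableStrataDoorOneSliceDefs.SingularProfileFloor`)

`singularProfileFloor_holds : SingularProfileFloor` — **the `L³`-floor of a singular Type-I profile** («ε-regularity in terms of
velocity only, under Type I»): for every `D > 0` there is `c = c(D) > 0` such that every door-class profile `v`
(`ZoomReturnDoorDefs.IsDoorProfile C v`) with the envelope `‖v(t,x)‖ ≤ D/(‖x‖ + √(−t))` (`HasTypeIDecay D v`) that is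
backward-singular at the apex carries Seregin's scale-invariant floor `c·r² ≤ ∫_{Q(r)} |v|³` at EVERY `r > 0` (`HasL3Floor c v`).

PROOF (all inputs are tree theorems; the constants are fixed BEFORE the profile).  The door class lies in `IsTypeIAncientMild D`
(`PoloidalWindowDoorPoloidalWindowRigidityWindow.isTypeIAncientMild_of_class`), so `v` is classical on `(−∞,0) × ℝ³` for one
pressure (`exists_isClassicalNSSolutionOn_Iio_of_isTypeIAncientMild`), hence for its RIESZ pressure `Q[v(t)] = RᵢRⱼ(vᵢvⱼ)`
(`RellichScarScarRigidity.isClassicalNSSolutionOn_rieszPressure`) with the class-uniform scale-invariant bounds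
`|Q[v(t)](x)| (‖x‖+√(−t))² ≤ K_p(D)` (`RellichScarScarRigidity.stub_apexRegPressureBounds`, order `0`) and
`‖∇v(t,x)‖ (‖x‖+√(−t))² ≤ K_v(D)` (`SymmetricScarExists.LogtimeBernoulli.exists_weight_pow_mul_norm_iteratedFDeriv_le`);
`(v, Q[v])` is suitable on the open slab with weak gradient `∇v` (`FrequencyRigidity.ScaledEnergySplit.stub_classicalSuitableSlab`).
At the apex, at EVERY scale: `A(r) < ∞` (slices `≤ D²|x|⁻²`), `E(r) < ∞` (`|∇v|²_F ≤ 3K_v²(‖x‖+√(−t))⁻⁴ ≤ 3K_v²|x|^{−5/2}(−t)^{−3/4}`),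
and UNIFORMLY `D(ρ) ≤ L(D) := K_p^{3/2} ∬_{Q(1)} (‖x‖+√(−t))⁻³` — pointwise majorant plus the exact parabolic scaling
`∬_{Q(ρ)} (‖x‖+√(−t))⁻³ = ρ² ∬_{Q(1)} (‖x‖+√(−t))⁻³` (`setLIntegral_preimage_comp_stAffine`), the unit integral being finite by the
separated Type-I majorant (`lintegral_typeI_cube_lt_top`, Pineau–Vicol 2026, proof of Prop. 9.5).  Seregin's cubic lower bound
at a backward-singular point under a `D`-level (Seregin 2014, Prop. 6.20 (6.6.1); ESS 2003 §5; tree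
`Seregin2020.exists_le_cknC_of_isBackwardSingularPoint L`) then gives `κ(L) ≤ C(r; 0)` for every `r > 0`
(`StableStrataDoorAlongTimes.hasL3Floor_of_le_cknC`).

Door family of LADDER-NS N0 (door S26 / SEED-26; `--supports stmt-NavierStokesRegularity-0056`, helper lane; nsreg-p6 g15): with
I1a (`localPointZoomAlongTimesSing_holds`) the modular split I1 = I1a + I1b is complete; beyond S26 it is a profile-side
NONTRIVIALITY CERTIFICATE for every door whose K1-zoom outputs a backward-singular door-class profile with `HasTypeIDecay (M/ν)`
(S20–S25, S27).  WHAT THIS IS NOT: not NS regularity (Clay A); a theorem INSIDE the Type-I profile class; no route, no item.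

References: G. Seregin, *Lecture Notes on Regularity Theory for the Navier–Stokes Equations* (2014), Prop. 6.20 (6.6.1), §6.3
Prop. 3.11 [Seregin2014]; L. Escauriaza, G. Seregin, V. Šverák, Russian Math. Surveys 58 (2003), §5 [ESS2003]; L. Caffarelli,
R. Kohn, L. Nirenberg, CPAM 35 (1982), §2 [CaffarelliKohnNirenberg1982]; G. Koch, N. Nadirashvili, G. Seregin, V. Šverák, Acta
Math. 203 (2009), §4, Thm. 6.1 [KochNadirashviliSereginSverak2009]; B. Pineau, V. Vicol, arXiv:2607.09619 (2026), Lemma 2.1,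
Lemma 7.1, Prop. 9.5 [PineauVicol2026].
-/

noncomputable section

set_option linter.dupNamespace false

namespace Summit.NavierStokesRegularity.NavierStokesRegularity.Theorems.StableStrataDoorSingularProfileFloor

open MeasureTheory Set Function Filter Topology TopologicalSpace Metric
open Literature.Analysis Literature.Analysis.FluidPDE
open Summit.NavierStokesRegularity.NavierStokesRegularity.Theorems
open Summit.NavierStokesRegularity.NavierStokesRegularity.Theorems.StableStrataDoorOneSliceDefs
open Summit.NavierStokesRegularity.NavierStokesRegularity.Theorems.StableStrataDoorSingularProfileTools
open Summit.NavierStokesRegularity.NavierStokesRegularity.Theorems.ZoomReturnDoorDefs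
open scoped NNReal ENNReal

/-! ### I1b -/

/-- **I1b · THE `L³`-FLOOR OF A SINGULAR TYPE-I PROFILE — PROVED.**  For every `D > 0` there is `c = c(D) > 0` such that every
door-class profile with the Type-I envelope `D/(‖x‖+√(−t))` that is backward-singular at the apex has `c·r² ≤ ∫_{Q(r)}|v|³`
at every scale `r > 0` (module docstring: Riesz-pressure package of the class + suitability of classical solutions +
class-uniform `D`-level + Seregin's cubic lower bound at a singular point; Seregin 2014, Prop. 6.20 (6.6.1)). -/
theorem singularProfileFloor_holds : SingularProfileFloor := by
  intro D hD
  -- ### constants, fixed before the profile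
  obtain ⟨Kp, hKp0, hKp⟩ := RellichScarScarRigidity.stub_apexRegPressureBounds 0 D
  obtain ⟨Kv, hKv0, hKv⟩ := SymmetricScarExists.LogtimeBernoulli.exists_weight_pow_mul_norm_iteratedFDeriv_le 1 D
  set I : ℝ≥0∞ := ∫⁻ z in parabolicCylinder 1 (0 : ℝ × EuclideanSpace ℝ (Fin 3)),
    ENNReal.ofReal (((‖z.2‖ + Real.sqrt (-z.1)) ^ 3)⁻¹) with hI
  have hIt : I ≠ ⊤ := lintegral_invCubeWeight_unit_lt_top.ne
  set Lenn : ℝ≥0∞ := ENNReal.ofReal (Kp ^ (3 / 2 : ℝ)) * I with hLenn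
  have hLt : Lenn ≠ ⊤ := ENNReal.mul_ne_top ENNReal.ofReal_ne_top hIt
  set L : ℝ≥0 := Lenn.toNNReal with hL
  have hLcoe : (L : ℝ≥0∞) = Lenn := ENNReal.coe_toNNReal hLt
  obtain ⟨κ, hκ, H⟩ := Seregin2020.exists_le_cknC_of_isBackwardSingularPoint L
  refine ⟨κ, hκ, fun C v hdoor hdec hsing => ?_⟩
  -- ### the profile: classical with its Riesz pressure, suitable on the slab
  obtain ⟨-, hcont, hmild, hdiv⟩ := hdoor
  have hA : IsTypeIAncientMild D v :=
    PoloidalWindowDoorPoloidalWindowRigidityWindow.isTypeIAncientMild_of_class (hdec.hasTypeITimeDecay hD.le)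
      hcont hmild hdiv
  obtain ⟨q, hsol⟩ := exists_isClassicalNSSolutionOn_Iio_of_isTypeIAncientMild hA
  have hsolQ := RellichScarScarRigidity.isClassicalNSSolutionOn_rieszPressure hsol hdec
  obtain ⟨hsw, hG⟩ := FrequencyRigidity.ScaledEnergySplit.stub_classicalSuitableSlab v _ hsolQ
  -- ### the scale-invariant bounds of the pair `(v, Q[v])`
  have hQpt : ∀ t < (0 : ℝ), ∀ x : EuclideanSpace ℝ (Fin 3),
      |(fun t x => pressurePotential (v t) x) t x| ≤ Kp / (‖x‖ + Real.sqrt (-t)) ^ 2 := by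
    intro t ht x
    have h := hKp v _ hsolQ hdec t ht x
    rw [norm_iteratedFDeriv_zero, Real.norm_eq_abs] at h
    have ha : 0 < (‖x‖ + Real.sqrt (-t)) ^ (0 + 2) := by
      have := Real.sqrt_pos.2 (neg_pos.2 ht); positivity
    rw [le_div_iff₀ (by simpa using ha), mul_comm]
    simpa using h
  have hGpt : ∀ t < (0 : ℝ), ∀ x : EuclideanSpace ℝ (Fin 3),
      ‖(fun t x => fderiv ℝ (v t) x) t x‖ ≤ Kv / (‖x‖ + Real.sqrt (-t)) ^ 2 := by
    intro t ht x
    have h := hKv v _ hsolQ hdec t ht x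
    have ha : 0 < (‖x‖ + Real.sqrt (-t)) ^ (1 + 1) := by
      have := Real.sqrt_pos.2 (neg_pos.2 ht); positivity
    dsimp only
    rw [← norm_iteratedFDeriv_zero (𝕜 := ℝ) (f := fderiv ℝ (v t)), norm_iteratedFDeriv_fderiv,
      le_div_iff₀ (by simpa using ha), mul_comm]
    simpa using h
  -- ### Seregin's floor at every scale
  have hsub : ∀ r : ℝ, parabolicCylinder r (0 : ℝ × EuclideanSpace ℝ (Fin 3)) ⊆
      ((slab (EuclideanSpace ℝ (Fin 3)) (Iio 0) isOpen_Iio : Opens (ℝ × EuclideanSpace ℝ (Fin 3))) :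
        Set (ℝ × EuclideanSpace ℝ (Fin 3))) := fun r => by
    rw [coe_slab]; exact parabolicCylinder_origin_subset_slab r
  have key : ∀ r : ℝ, 0 < r → ENNReal.ofReal κ ≤ cknC r (0 : ℝ × EuclideanSpace ℝ (Fin 3)) v := by
    intro r hr
    refine H _ v _ _ hsw hG 0 r hr (hsub r) (cknAEss_ne_top_of_hasTypeIDecay hD.le hdec hr)
      (cknE_ne_top_of_gradient_decay hGpt hr) (fun ρ hρ => ?_) hsing r ⟨hr, le_rfl⟩
    rw [hLcoe, hLenn, hI]
    exact cknD_le_of_sq_decay hKp0 hQpt hρ.1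
  exact StableStrataDoorAlongTimes.hasL3Floor_of_le_cknC hκ.le (ae_of_all _ fun _ => rfl) key

end Summit.NavierStokesRegularity.NavierStokesRegularity.Theorems.StableStrataDoorSingularProfileFloor

end
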